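import Mathlib
import Literature.Geometry.Lorentzian.KerrSchild
import HarnessLib

/-!
# CoarsePoincareStability

Topic `Literature/Uncategorized`. Named literature fact(s) relocated by the gate from `Summits/FinalStateConjecture/FinalStateConjecture/Theorems/StarvedNecksGapDecaySufficesStubUniformLocationDefs.lean`
(accept-time relocation of `[cite]`d propositions written inline in a Summits proposal; human ruling 2026-08-15).

* `Literature.Uncategorized.CoarsePoincareStability`
* `Literature.Uncategorized.CoarselyFramedPoincareStability`
* `Literature.Uncategorized.FramedPoincareStability`
-/

namespace Literature.Uncategorized

open Set Filter Topology Literature.Geometry.Lorentzian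

/-- **`CoarsePoincareStability` (scale-free; REFUTED by `not_coarsePoincareStability`).**
For every `ε > 0` there would be `δ₀ > 0` such that: a `C¹` injective map `k` of the ball
`B(x₀, 20ℓ) ⊆ E4` whose differential is at every point an exact isometry from `η + h₁(x)` to
`η + h₂(k x)` with `‖h₁(x)‖, ‖h₂(k x)‖ ≤ δ ≤ δ₀`, pushing `∂₀` forward in coordinate time, is on
`B(x₀, ℓ)` `εℓ`-close IN THE DOMAIN FRAME (`k y = A (y + e) + c`, `‖e‖ ≤ εℓ`) to an affine map with
`ε`-approximately Lorentz linear part — with NO bound on `Dk` or on `A` at any scale.  False for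
every `ε < 1/50`: the linear part may be a boost of rapidity `β` with `δ e^{2β} ≫ 1`. [folklore] -/
def CoarsePoincareStability : Prop :=
  ∀ ε : ℝ, 0 < ε → ∃ δ₀ : ℝ, 0 < δ₀ ∧
    ∀ (δ ℓ : ℝ) (x₀ : E4) (k : E4 → E4) (h₁ h₂ : E4 → E4 →L[ℝ] E4 →L[ℝ] ℝ),
      0 < δ → δ ≤ δ₀ → 0 < ℓ →
      ContDiffOn ℝ 1 k (Metric.ball x₀ (20 * ℓ)) → InjOn k (Metric.ball x₀ (20 * ℓ)) →
      (∀ x ∈ Metric.ball x₀ (20 * ℓ), ‖h₁ x‖ ≤ δ) →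
      (∀ x ∈ Metric.ball x₀ (20 * ℓ), ‖h₂ (k x)‖ ≤ δ) →
      (∀ x ∈ Metric.ball x₀ (20 * ℓ), ∀ v w : E4,
        (Minkowski.bilin + h₂ (k x)) (fderiv ℝ k x v) (fderiv ℝ k x w) =
          (Minkowski.bilin + h₁ x) v w) →
      (∀ x ∈ Metric.ball x₀ (20 * ℓ), 0 < fderiv ℝ k x (E4.basisVector 0) 0) →
      ∃ (A : E4 →L[ℝ] E4) (c : E4),
        (∀ v w : E4,
          |Minkowski.bilin (A v) (A w) - Minkowski.bilin v w| ≤ ε * ‖v‖ * ‖w‖) ∧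
        ∀ y ∈ Metric.ball x₀ ℓ, ∃ e : E4, ‖e‖ ≤ ε * ℓ ∧ k y = A (y + e) + c

/-- **`FramedPoincareStability` (tame regime; PROVED as `framedPoincareStability`).**
For every operator bound `Γ ≥ 1` there are `C, δ₀ > 0` and a domain ratio `R ≥ 20` such that: if
`k` is differentiable on `D = B(x₀, Rℓ)` and `g` on `D' = B(k x₀, Rℓ)` with `g (k x) = x` on `D`,
`‖Dk‖ ≤ Γ` on `D`, `‖Dg‖ ≤ Γ` on `D'`, `‖h₁‖ ≤ δ` on `D`, `‖h₂‖ ≤ δ` on `D'` (`0 < δ ≤ δ₀`), and the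
differentials are exact isometries `η + h₁(x) → η + h₂(k x)` (for `k`) and
`η + h₂(y) → η + h₁(g y)` (for `g`), then on `B(x₀, ℓ)` the map `k` is `Cδℓ`-close in the domain
frame to an affine map with `Cδ`-approximately Lorentz linear part.  (Two one-sided interval
comparisons + quantitative Alexandrov–Zeeman.) [folklore] -/
def FramedPoincareStability : Prop :=
  ∀ Γ : ℝ, 1 ≤ Γ → ∃ C δ₀ R : ℝ, 0 < C ∧ 0 < δ₀ ∧ 20 ≤ R ∧
    ∀ (δ ℓ : ℝ) (x₀ : E4) (k g : E4 → E4) (h₁ h₂ : E4 → E4 →L[ℝ] E4 →L[ℝ] ℝ),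
      0 < δ → δ ≤ δ₀ → 0 < ℓ →
      DifferentiableOn ℝ k (Metric.ball x₀ (R * ℓ)) →
      DifferentiableOn ℝ g (Metric.ball (k x₀) (R * ℓ)) →
      (∀ x ∈ Metric.ball x₀ (R * ℓ), g (k x) = x) →
      (∀ x ∈ Metric.ball x₀ (R * ℓ), ‖fderiv ℝ k x‖ ≤ Γ) →
      (∀ y ∈ Metric.ball (k x₀) (R * ℓ), ‖fderiv ℝ g y‖ ≤ Γ) →
      (∀ x ∈ Metric.ball x₀ (R * ℓ), ‖h₁ x‖ ≤ δ) →
      (∀ y ∈ Metric.ball (k x₀) (R * ℓ), ‖h₂ y‖ ≤ δ) →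
      (∀ x ∈ Metric.ball x₀ (R * ℓ), ∀ v w : E4,
        (Minkowski.bilin + h₂ (k x)) (fderiv ℝ k x v) (fderiv ℝ k x w) =
          (Minkowski.bilin + h₁ x) v w) →
      (∀ y ∈ Metric.ball (k x₀) (R * ℓ), ∀ v w : E4,
        (Minkowski.bilin + h₁ (g y)) (fderiv ℝ g y v) (fderiv ℝ g y w) =
          (Minkowski.bilin + h₂ y) v w) →
      ∃ (A : E4 →L[ℝ] E4) (c : E4),
        (∀ v w : E4,
          |Minkowski.bilin (A v) (A w) - Minkowski.bilin v w| ≤ C * δ * ‖v‖ * ‖w‖) ∧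
        ∀ y ∈ Metric.ball x₀ ℓ, ∃ e : E4, ‖e‖ ≤ C * δ * ℓ ∧ k y = A (y + e) + c

/-- **`CoarselyFramedPoincareStability` (the E4 residual of X₁ as stated; OPEN).**  As
`FramedPoincareStability`, but the pointwise operator bounds are replaced by COARSE Lipschitz
bounds AT THE SCALE `ℓ` ONLY — `‖k y − k x‖ ≤ Γ‖y − x‖` for `x, y ∈ D` with `‖y − x‖ ≥ ℓ`, and the
same for `g` on `D'` — so that boost flashes with unbounded pointwise rapidity below the scale `ℓ`
are admitted; both maps push `∂₀` forward in coordinate time.  Conclusion unchanged.  WHY TRUE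
(paper): for a steep pair at scale `≥ ℓ` the `k`-image of its `δ`-narrowed causal diamond lies in
the `δ`-widened diamond of the image pair (pointwise cone comparison along segments, Darboux for the
orientation), `|det Dk| ≥ 1 − Cδ` and diamond volumes are `c₄τ⁴` (up to factors `1 ± C(Γ)δ` for the
narrowed / widened ones at bounded Euclidean slope), whence the LOWER interval bound
`τ(kx, ky)² ≥ (1 − C(Γ)δ)τ(x, y)²`; the same for `g` on image pairs (steep with margin `1/(5Γ²)`)
is the upper bound; the simplex fit of `quantAlexandrovZeeman_ball` uses only pairs of size
`≥ 3ℓ`. [folklore] -/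
def CoarselyFramedPoincareStability : Prop :=
  ∀ Γ : ℝ, 1 ≤ Γ → ∃ C δ₀ R : ℝ, 0 < C ∧ 0 < δ₀ ∧ 20 ≤ R ∧
    ∀ (δ ℓ : ℝ) (x₀ : E4) (k g : E4 → E4) (h₁ h₂ : E4 → E4 →L[ℝ] E4 →L[ℝ] ℝ),
      0 < δ → δ ≤ δ₀ → 0 < ℓ →
      DifferentiableOn ℝ k (Metric.ball x₀ (R * ℓ)) →
      DifferentiableOn ℝ g (Metric.ball (k x₀) (R * ℓ)) →
      (∀ x ∈ Metric.ball x₀ (R * ℓ), g (k x) = x) →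
      (∀ x ∈ Metric.ball x₀ (R * ℓ), ∀ y ∈ Metric.ball x₀ (R * ℓ),
        ℓ ≤ ‖y - x‖ → ‖k y - k x‖ ≤ Γ * ‖y - x‖) →
      (∀ x ∈ Metric.ball (k x₀) (R * ℓ), ∀ y ∈ Metric.ball (k x₀) (R * ℓ),
        ℓ ≤ ‖y - x‖ → ‖g y - g x‖ ≤ Γ * ‖y - x‖) →
      (∀ x ∈ Metric.ball x₀ (R * ℓ), ‖h₁ x‖ ≤ δ) →
      (∀ y ∈ Metric.ball (k x₀) (R * ℓ), ‖h₂ y‖ ≤ δ) →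
      (∀ x ∈ Metric.ball x₀ (R * ℓ), ∀ v w : E4,
        (Minkowski.bilin + h₂ (k x)) (fderiv ℝ k x v) (fderiv ℝ k x w) =
          (Minkowski.bilin + h₁ x) v w) →
      (∀ y ∈ Metric.ball (k x₀) (R * ℓ), ∀ v w : E4,
        (Minkowski.bilin + h₁ (g y)) (fderiv ℝ g y v) (fderiv ℝ g y w) =
          (Minkowski.bilin + h₂ y) v w) →
      (∀ x ∈ Metric.ball x₀ (R * ℓ), 0 < fderiv ℝ k x (E4.basisVector 0) 0) →
      (∀ y ∈ Metric.ball (k x₀) (R * ℓ), 0 < fderiv ℝ g y (E4.basisVector 0) 0) →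
      ∃ (A : E4 →L[ℝ] E4) (c : E4),
        (∀ v w : E4,
          |Minkowski.bilin (A v) (A w) - Minkowski.bilin v w| ≤ C * δ * ‖v‖ * ‖w‖) ∧
        ∀ y ∈ Metric.ball x₀ ℓ, ∃ e : E4, ‖e‖ ≤ C * δ * ℓ ∧ k y = A (y + e) + c

end Literature.Uncategorized
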